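import Summits.BirchSwinnertonDyer.Rank1Residual.X11b.YZCompositeAlgebra
import Summits.BirchSwinnertonDyer.Rank1Residual.X11b.FrameLambdaUnit
import Summits.BirchSwinnertonDyer.Rank1Residual.X11b.RouteR1IMCEqCoreFrame
import Summits.BirchSwinnertonDyer.Rank1Residual.X11b.EmbeddingDatumPrime
import Literature.FieldTheory.AlgClosed.PadicAlgClEquivComplex
import Literature.NumberTheory.EllipticCurves.YanZhu2026.BDPMainConjectureAtTrivialCharacterOfHeegnerDivisibility
import Literature.NumberTheory.EllipticCurves.YanZhu2026.AnticyclotomicMainTheorems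
import Literature.NumberTheory.EllipticCurves.BurungaleCastellaSkinner2025.BDPMainConjecture
import Literature.NumberTheory.EllipticCurves.CastellaGrossiLeeSkinner2022.IMC2DivisibilityAndBDPValueFrame
import Literature.NumberTheory.EllipticCurves.ModularityVersionApProofs
import Literature.NumberTheory.EllipticCurves.ModularParametrizationBCDTProofs
import Literature.NumberTheory.EllipticCurves.CuspFormLFunctionLevelConductorProofs
import HarnessLib

set_option autoImplicit false

/-!
# The two Yan–Zhu ∘ BCS ∘ CGLS composites at the trivial character, DERIVED from the four
# single-source named facts on `IsBDPLFunction` frames and the tree's frame rigidity — no composite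

Cell `pub/bsd-print-x9` (D-0131 (2) PRINT tier; leaves X9 = irreducible NON-surjective image at a good
ordinary `p ∈ {5, 7}`, X10b = the same at `p = 3`), typer seat ty1 (gen 16). THEOREMS ONLY (no
definition, no named fact, no `sorry`); nothing about any curve is asserted; PARTITION: 0 cells move.

## What this file does

The cell's J-free HOWARD ROAD (A) (p4 `PrintX9HowardIMCLink/RankOne`, ty2 files Q/R/S) consumes BY NAME
the named fact
`Literature.NumberTheory.EllipticCurves.YanZhu2026.thm57_thm59_bcs422_cgls513_generator_constantCoeff_of_heegnerDivisibility`
(`hYZ`, p563407; AUTHOR-FLAGGED `YZ26-57i+59+BCS422+CGLS513-composite`, REF-85: "any by-name leaf closure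
through hYZ is OUTSIDE PARTITION currency until the flag is lifted/discharged"), and the X9 leaf kernel
consumes its one-sided sibling `…thm57_bcs422_cgls513_generator_constantCoeff` (p543659; flag
`YZ26-57i+BCS422-mu-composite`). Both were TYPED as composites because "each [single-source fact]
concludes `∃ (Ω_K, Ω_p, L), IsBDPLFunction … L ∧ …` for ITS OWN frame, and nothing in the tree
identifies two frames of `𝓛_p^BDP`" (p563407's module docstring). That obstruction is GONE: the tree
PROVES frame rigidity across periods — `X11b.R1.span_singleton_eq_of_isBDPLFunction` (equal ideals of
`R₀⟦T⟧`) and `X11b.constantCoeff_eq_of_isBDPLFunction` (equal constant terms), cell b2b-bsdres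
(multr1-p1/p2, x11b3-p3) — so here BOTH composite `Prop`s are PROVED, LETTER FOR LETTER, from

* `YanZhu2026.thm57_isTorsion_charIdealXGr_eq_bdpLFunction` (Yan–Zhu 2026 Thm. 5.7 (1), rational),
* `YanZhu2026.thm59_XGr_isTorsion_bdp_iff_heegnerPoint_localised` (Thm. 5.9, the Heegner ⟺ BDP transfer),
* `BurungaleCastellaSkinner2025.prop422_exists_isBDPLFunction_mu_eq_zero` (BCS 2025 Prop. 4.2.2, `μ = 0`),
* `CastellaGrossiLeeSkinner2022.thm513_exists_isBDPLFunction_valueAtOne_disc` (CGLS 2022 Thm. 5.1.3 with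
  (disc), the BDP formula at `𝟙`),
* `ModularForms.IsNewformOf.level_eq_conductorNorm` (Carayol 1986: the level of the composite's free
  parametrisation datum `Dt : ModularParametrizationData W N` is `N_E`),

plus tree THEOREMS only: the two rigidity theorems, the embedding datum `X11b.exists_datum_forall_mem_iff`
(+ Steinitz `PadicAlgCl.nonempty_ringEquiv_complex`), Darmon 2004 Prop. 3.11 DISCHARGED
(`heegnerPoint_conj_add_rootNumber_smul_holds`: complex conjugation acts on `P_K` by `−w(E)` up to
torsion — used to pass from the composite's arbitrary complex embedding `ι_ℂ` to THE infinite place of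
CGLS Thm. 5.1.3's fact WITHOUT a rank hypothesis), the `R₀⟦T⟧`-algebra of bsd-eis
(`X1.KellerYinHalves.exists_mul_eq_of_mul_eq_C_pow_mul`, `exists_unit_constantCoeff_eq`, …) and the
principal characteristic ideal (`charIdeal_isPrincipal_holds`).

File 2 of 2: the algebra of `R₀⟦T⟧` (§1: the μ-comparison `span_eq_of_C_pow_mul_mem_of_mem`, its one-sided
form `exists_eq_C_pow_mul_unit_mul`) and the rank-free log symmetry (§2:
`sq_padicLogOmega_map_eq_of_isHeegnerPoint`, `exists_algHom_map_map_eq`) are the companion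
`X11b/YZCompositeAlgebra.lean`; here:

* §3 `thm57_thm59_bcs422_cgls513_of_heegnerDivisibility_of_printFacts` — the flagged composite `hYZ` IS A
  THEOREM from the five single-source facts; §4 `thm57_bcs422_cgls513_of_printFacts` — the one-sided
  sibling likewise, and through the landed porting term BCS's
  `thm124a_prop422_thm513_generator_constantCoeff` (`thm124a_prop422_thm513_of_printFacts`).

Effect for the cell: every consumer keeps `hYZ` BY NAME and is fed `…_of_printFacts h57 h59 h422 h513 hC`
at the leaf; the composite flags leave the census (the five inputs are verbatim print statements, each
with its own page-level cite; the `p = 3` provenance flag `YZ26@3-BF-ERL-Ohta` of Thm. 5.7 (1) is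
inherited unchanged). Precedent: `X11b/CW53CompositeOfFrames.lean` (cell bsd-print-x6). «beyond-print
theorem»: no — bookkeeping over landed facts and theorems.

References: [YanZhu2024MainConjNonCM] Thm. 5.7 (1), Thm. 5.9, proof of Thm. 5.7 (arXiv:2412.20078v4
l.1217–1308); [BurungaleCastellaSkinner2025] Prop. 4.2.2, Thm. 4.2.1 (proof, p. 8); [CastellaGrossiLeeSkinner2022]
Thm. 5.1.3; [Carayol1986]; [Darmon2004] Prop. 3.11; [Castella2018] Thm. 3.1 (the frame); [Washington1997] §7.1.
-/

noncomputable section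

open scoped Classical

open PowerSeries WeierstrassCurve NumberField IsDedekindDomain Field
  Literature.NumberTheory.EllipticCurves Literature.NumberTheory.EllipticCurves.ModularForms
  Literature.NumberTheory.EllipticCurves.Rank1Residual
  Literature.NumberTheory.EllipticCurves.Castella2018
  Literature.NumberTheory.EllipticCurves.YanZhu2026
  Literature.NumberTheory.EllipticCurves.CastellaGrossiLeeSkinner2022
  Summit.BirchSwinnertonDyer.Rank1Residual
  Summit.BirchSwinnertonDyer.Rank1Residual.X11b.Halves
  Summit.BirchSwinnertonDyer.Rank1Residual.X1.KellerYinHalves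

namespace Summit.BirchSwinnertonDyer.Rank1Residual.X11b.YZComposite

/-! ### §3 The TWO-SIDED composite `hYZ` (p563407) is a theorem from the five single-source facts -/

section TwoSided

/-- **Yan–Zhu 2026 Thm. 5.7 (1) + Thm. 5.9 + BCS 2025 Prop. 4.2.2 + CGLS 2022 Thm. 5.1.3 at the trivial
character, GRANTED Howard's containment — the named fact
`YanZhu2026.thm57_thm59_bcs422_cgls513_generator_constantCoeff_of_heegnerDivisibility` (ty1 g8, p563407;
flag `YZ26-57i+59+BCS422+CGLS513-composite`) PROVED, letter for letter, from the four single-source named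
facts on `IsBDPLFunction` frames and Carayol's level fact.** Per datum: Carayol (`hC`) gives `N = N_E`;
`p ∈ v`, an embedding datum `ι'` inducing `v` (Steinitz + `X11b.exists_datum_forall_mem_iff`); the four
frames `L₁` (Thm. 5.7 (1): torsion, `p^k'·(F) ⊆ (L₁)` along `toUnr`), `L₃` (Thm. 5.9 at `S = {1}` fed with
the containment hypothesis: `L₃ ∈ (F)`), `L₂` (Prop. 4.2.2: a unit coefficient), `L₄` (Thm. 5.1.3 at
`τ_* P` read through THE infinite place: `L₄(𝟙) = u·c_E⁻²(1 − a_p p⁻¹ + p⁻¹)²(log_{ω_E} τ_* P)²`) of the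
SAME `(ι', v, κ, γ, f_E)` generate the same ideal and have the same constant term
(`X11b.R1.span_singleton_eq_of_isBDPLFunction`, `X11b.constantCoeff_eq_of_isBDPLFunction`); the
μ-comparison of §1 gives `(F)·R₀⟦T⟧ = (L₁)`; `(log τ_* P)² = (log P)²` by §2 (Darmon Prop. 3.11); and
`F(0) = u'·V`, `u' ∈ ℤ_pˣ` by `X1.KellerYinHalves.exists_unit_constantCoeff_eq`. No image hypothesis, no
rank hypothesis, every `p ≥ 3`.
[cite: YanZhu2024MainConjNonCM, Thm. 5.7 (1) and Thm. 5.9 (arXiv:2412.20078v4 TeX l.1217–1227, l.1283–1293), proof of Thm. 5.7 (l.1294–1308)]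
[cite: BurungaleCastellaSkinner2025, Prop. 4.2.2 (p. 9) and Thm. 4.2.1, proof (p. 8)]
[cite: CastellaGrossiLeeSkinner2022, Thm. 5.1.3 (TeX `thmpadicGZ` L2463–L2471) with §2 (disc)]
[cite: Carayol1986] [cite: Darmon2004, Prop. 3.11] [cite: Castella2018, Thm. 3.1 (the frame `IsBDPLFunction`)] -/
theorem thm57_thm59_bcs422_cgls513_of_heegnerDivisibility_of_printFacts
    (h57 : thm57_isTorsion_charIdealXGr_eq_bdpLFunction)
    (h59 : thm59_XGr_isTorsion_bdp_iff_heegnerPoint_localised)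
    (h422 : BurungaleCastellaSkinner2025.prop422_exists_isBDPLFunction_mu_eq_zero)
    (h513 : thm513_exists_isBDPLFunction_valueAtOne_disc)
    (hC : ∀ (N : ℕ) [NeZero N], IsNewformOf.level_eq_conductorNorm (N := N)) :
    thm57_thm59_bcs422_cgls513_generator_constantCoeff_of_heegnerDivisibility := by
  intro W _ _ p _ hp hord K _ _ hK hHN hHp hodd h3 hirrK hhK ι v vbar hv hvbar hne κ hκ γ _ N _ Dt H
    ιC P hP hHow
  have hpp : p.Prime := Fact.out
  have hp2 : p ≠ 2 := by omega
  have hp2' : 2 < p := by omega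
  have hγ : κ.IsTopGenerator γ := Fact.out
  -- Carayol: the level of the parametrisation datum is the conductor
  have hNc : N = W.conductorNorm ℤ := hC N Dt.isNewformOf
  subst hNc
  -- `p ∈ v`, `p` split, `p ∤ N_E`, the embedding datum `ι'` inducing `v`
  have hpv : ((p : ℕ) : 𝓞 K) ∈ v.asIdeal := by
    -- `‖ι(p)‖ = p⁻¹ < 1` (as `X11b.natCast_mem_of_forall_mem_iff_norm_lt`, CW53CompositeOfFrames)
    rw [hv, show ι (((p : ℕ) : 𝓞 K) : K) = (p : ℚ_[p]) by simp]
    exact Padic.norm_p_lt_one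
  have hsplit : ((Ideal.span {(p : ℤ)}).primesOver (𝓞 K)).ncard = 2 := hHp p hpp (dvd_refl p)
  have hgood : W.HasGoodReductionAtPrime p := hord.1
  have hpN : ¬ p ∣ W.conductorNorm ℤ := fun h ↦
    (W.dvd_conductorNorm_iff_not_hasGoodReductionAtPrime p).mp h hgood
  obtain ⟨ι₀⟩ := PadicAlgCl.nonempty_ringEquiv_complex p
  obtain ⟨ι', -, hι'⟩ := X11b.exists_datum_forall_mem_iff p ι₀ hK hpv
  -- the setting of Yan–Zhu §5.2 for Thm. 5.9
  have hyp57 : Thm57Hypotheses (W.conductorNorm ℤ) W K p κ γ :=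
    { isElliptic := inferInstance, level := rfl, three_le := hp, goodOrd := hord, irreducible := hirrK,
      isImaginaryQuadratic := hK, heegner := hHN, discr_odd := hodd, discr_ne := h3, split := hsplit,
      not_dvd_classNumber := hhK, anticyclotomic := hκ, topGenerator := hγ }
  -- frame 1: Thm. 5.7 (1) — torsion and the rational `⊆`
  obtain ⟨ΩK₁, Ωp₁, L₁, hΩK₁, hL₁, htors, hrat⟩ :=
    h57 ι' W K v vbar κ γ Dt.isNewformOf hp hord hirrK hK hHN hsplit hodd h3 hι' hvbar hne hκ
  obtain ⟨⟨-, k', hk'⟩, -⟩ := hrat (toUnr p) (coe_toUnr p)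
  -- frame 3: Thm. 5.9 fed with Howard's containment — `L₃ ∈ ch·R₀⟦T⟧`
  obtain ⟨jbar, D, Fh, X, hle⟩ := hHow
  obtain ⟨ΩK₃, Ωp₃, L₃, hΩK₃, hL₃, hmem⟩ :=
    bdp_mem_of_heegner_le_of_thm59 h59 ι' W v vbar κ γ jbar hyp57 Dt.isNewformOf hι' hvbar hne
  have hL₃mem := hmem D Fh X (toUnr p) (coe_toUnr p) hle
  -- frame 2: Prop. 4.2.2 — a unit coefficient
  obtain ⟨ΩK₂, Ωp₂, L₂, hΩK₂, hL₂, hμ⟩ :=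
    h422 ι' W K v κ γ Dt.isNewformOf hp2' hgood hK hHN hsplit hodd h3 hirrK hpv hι' hκ hγ
  -- frame 4: Thm. 5.1.3 at `τ_* P`, read through THE infinite place
  obtain ⟨w₀⟩ := (inferInstance : Nonempty (InfinitePlace K))
  obtain ⟨τ, hP'⟩ := exists_algHom_map_map_eq hK ιC w₀ Dt H hP
  obtain ⟨ΩK₄, Ωp₄, L₄, hΩK₄, hL₄, u, hu⟩ :=
    h513 ι' W K v κ γ Dt H w₀ ι (WeierstrassCurve.Affine.Point.map (W' := W) τ P) hp2 hpN hK hsplit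
      hpv hι' hHN hodd h3 hκ hγ hP' hv
  -- frame rigidity: same ideal, same constant term
  have hΩp₁ := coe_units_ne_zero Ωp₁
  have hΩp₂ := coe_units_ne_zero Ωp₂
  have hΩp₃ := coe_units_ne_zero Ωp₃
  have hΩp₄ := coe_units_ne_zero Ωp₄
  have h21 : Ideal.span ({L₂} : Set (UnrSeries p)) = Ideal.span {L₁} :=
    X11b.R1.span_singleton_eq_of_isBDPLFunction hp2 hK hκ hγ hΩK₁ hΩK₂ hΩp₁ hΩp₂ hL₁ hL₂
  have h31 : Ideal.span ({L₃} : Set (UnrSeries p)) = Ideal.span {L₁} :=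
    X11b.R1.span_singleton_eq_of_isBDPLFunction hp2 hK hκ hγ hΩK₁ hΩK₃ hΩp₁ hΩp₃ hL₁ hL₃
  have h41 : PowerSeries.constantCoeff L₄ = PowerSeries.constantCoeff L₁ :=
    X11b.constantCoeff_eq_of_isBDPLFunction hp2 hK hκ hγ hΩK₁ hΩK₄ hΩp₁ hΩp₄ hL₁ hL₄
  -- a generator `F` of `ch_Λ(𝒳)`; the extended ideal is `(F')`, `F' = map toUnr F`
  obtain ⟨F, hF⟩ := (charIdeal_isPrincipal_holds p (Castella2018.AcSelmer.XAc (W.baseChange K) p κ vbar ∅ γ)).principal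
  have hF' : Castella2018.AcSelmer.XAc.charIdeal (W.baseChange K) p κ vbar ∅ γ = Ideal.span {F} := hF
  set F' : UnrSeries p := PowerSeries.map (toUnr p) F with hF'def
  have hI : (Castella2018.AcSelmer.XAc.charIdeal (W.baseChange K) p κ vbar ∅ γ).map (PowerSeries.map (toUnr p)) =
      Ideal.span {F'} := by
    rw [hF', Ideal.map_span, Set.image_singleton]
  -- (1) `C(p^k') · F' ∈ (L₁)`
  have h1 : C ((p : unrIntegers p) ^ k') * F' ∈ Ideal.span ({L₁} : Set (UnrSeries p)) :=
    hk' F' (by rw [hI]; exact Ideal.mem_span_singleton_self F')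
  -- (2) `L₁ ∈ (F')`
  have h2 : L₁ ∈ Ideal.span ({F'} : Set (UnrSeries p)) := by
    have hL₁3 : L₁ ∈ Ideal.span ({L₃} : Set (UnrSeries p)) := by
      rw [h31]; exact Ideal.mem_span_singleton_self L₁
    rw [hI] at hL₃mem
    exact (Ideal.span_singleton_le_iff_mem _).mpr hL₃mem hL₁3
  -- (3) `μ(L₁) = 0`
  obtain ⟨n, hn⟩ := exists_firstUnitCoeffAt_of_span_eq h21 hμ
  -- the μ-comparison: `(F') = (L₁)`
  have hspan : Ideal.span ({F'} : Set (UnrSeries p)) = Ideal.span {L₁} :=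
    span_eq_of_C_pow_mul_mem_of_mem h1 h2 hn
  -- the value at `𝟙`, moved to `L₁` and to `P`
  have hlog : padicLogOmega W p ι (WeierstrassCurve.Affine.Point.map (W' := W) τ P) ^ 2 =
      padicLogOmega W p ι P ^ 2 :=
    sq_padicLogOmega_map_eq_of_isHeegnerPoint W hK hHN ι ⟨Dt, H, ιC, hP⟩ τ
  rw [hlog] at hu
  have hval : L₁.HasValueAt 0 (((u : unrIntegers p) : ℂ_[p]) *
      algebraMap ℚ_[p] ℂ_[p] (((Dt.c : ℚ_[p])⁻¹) ^ 2 *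
        (1 - (W.frobeniusTrace p : ℚ_[p]) * (p : ℚ_[p])⁻¹ + (p : ℚ_[p])⁻¹) ^ 2 *
        padicLogOmega W p ι P ^ 2)) := by
    have h0 := UnrSeries.hasValueAt_zero L₁
    rw [← h41, ← UnrSeries.eq_constantCoeff_of_hasValueAt_zero hu] at h0
    exact h0
  obtain ⟨u', hu'⟩ := exists_unit_constantCoeff_eq hspan u hval
  refine ⟨htors, F, hF', u', ?_⟩
  rw [hu']
  unfold padicLogOmega
  ring

/-- **The same, with Carayol's level fact supplied by the modularity parametrisation fact** the cell's
leaves already carry (`nonempty_modularParametrizationData`, BCDT 2001): `IsNewformOf.level_eq_conductorNorm`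
at every level is a tree THEOREM from `exists_isNewformOf`
(`IsNewformOf.level_eq_conductorNorm_of_exists_isNewformOf'`, multiplicity one), itself from the
parametrisation fact (`exists_isNewformOf_of_nonempty_modularParametrizationData`). So at a leaf the binder
`hYZ` is literally `… h57 h59 h422 h513 hpar`. [cite: YanZhu2024MainConjNonCM, Thm. 5.7 (1) and Thm. 5.9]
[cite: BurungaleCastellaSkinner2025, Prop. 4.2.2] [cite: CastellaGrossiLeeSkinner2022, Thm. 5.1.3]
[cite: BCDTJAMS2001, Thm. A] [cite: Carayol1986] -/
theorem thm57_thm59_bcs422_cgls513_of_heegnerDivisibility_of_printFacts_of_modularity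
    (h57 : thm57_isTorsion_charIdealXGr_eq_bdpLFunction)
    (h59 : thm59_XGr_isTorsion_bdp_iff_heegnerPoint_localised)
    (h422 : BurungaleCastellaSkinner2025.prop422_exists_isBDPLFunction_mu_eq_zero)
    (h513 : thm513_exists_isBDPLFunction_valueAtOne_disc)
    (hpar : nonempty_modularParametrizationData) :
    thm57_thm59_bcs422_cgls513_generator_constantCoeff_of_heegnerDivisibility :=
  thm57_thm59_bcs422_cgls513_of_heegnerDivisibility_of_printFacts h57 h59 h422 h513
    fun _ _ ↦ IsNewformOf.level_eq_conductorNorm_of_exists_isNewformOf'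
      (exists_isNewformOf_of_nonempty_modularParametrizationData hpar)

end TwoSided

/-! ### §4 The ONE-SIDED composite (p543659) is a theorem from four single-source facts -/

section OneSided

/-- **Yan–Zhu 2026 Thm. 5.7 (1) (rational) + BCS 2025 Prop. 4.2.2 + CGLS 2022 Thm. 5.1.3 at the trivial
character — the named fact `YanZhu2026.thm57_bcs422_cgls513_generator_constantCoeff` (ty1 g2, p543659; flag
`YZ26-57i+BCS422-mu-composite`) PROVED from the three single-source frame facts and Carayol's level fact.**
As in §3 without the Heegner side: the two rational halves `p^k·(L₁) ⊆ (F)`, `p^k'·(F) ⊆ (L₁)` of Thm. 5.7 (1)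
and `μ(L₁) = 0` (Prop. 4.2.2 along rigidity) give `F' = p^m · U · L₁` (§1, one-sided); the value at `𝟙`
of Thm. 5.1.3 at `τ_* P` is moved to `L₁` (`X11b.constantCoeff_eq_of_isBDPLFunction`) and to `P` (§2);
`F(0) = u'·p^m·V` by `exists_unit_constantCoeff_eq` applied to `C(p^m)·L₁`.
[cite: YanZhu2024MainConjNonCM, Thm. 5.7 (1), first sentence (arXiv:2412.20078v4 TeX l.1217–1223)]
[cite: BurungaleCastellaSkinner2025, Prop. 4.2.2 (p. 9)]
[cite: CastellaGrossiLeeSkinner2022, Thm. 5.1.3 (TeX `thmpadicGZ` L2463–L2471) with §2 (disc)]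
[cite: Carayol1986] [cite: Darmon2004, Prop. 3.11] -/
theorem thm57_bcs422_cgls513_of_printFacts
    (h57 : thm57_isTorsion_charIdealXGr_eq_bdpLFunction)
    (h422 : BurungaleCastellaSkinner2025.prop422_exists_isBDPLFunction_mu_eq_zero)
    (h513 : thm513_exists_isBDPLFunction_valueAtOne_disc)
    (hC : ∀ (N : ℕ) [NeZero N], IsNewformOf.level_eq_conductorNorm (N := N)) :
    thm57_bcs422_cgls513_generator_constantCoeff := by
  intro W _ _ p _ hp hord K _ _ hK hHN hHp hodd h3 hirrK ι v vbar hv hvbar hne κ hκ γ _ N _ Dt H ιC P hP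
  have hpp : p.Prime := Fact.out
  have hp2 : p ≠ 2 := by omega
  have hp2' : 2 < p := by omega
  have hγ : κ.IsTopGenerator γ := Fact.out
  have hNc : N = W.conductorNorm ℤ := hC N Dt.isNewformOf
  subst hNc
  have hpv : ((p : ℕ) : 𝓞 K) ∈ v.asIdeal := by
    -- `‖ι(p)‖ = p⁻¹ < 1` (as `X11b.natCast_mem_of_forall_mem_iff_norm_lt`, CW53CompositeOfFrames)
    rw [hv, show ι (((p : ℕ) : 𝓞 K) : K) = (p : ℚ_[p]) by simp]
    exact Padic.norm_p_lt_one
  have hsplit : ((Ideal.span {(p : ℤ)}).primesOver (𝓞 K)).ncard = 2 := hHp p hpp (dvd_refl p)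
  have hgood : W.HasGoodReductionAtPrime p := hord.1
  have hpN : ¬ p ∣ W.conductorNorm ℤ := fun h ↦
    (W.dvd_conductorNorm_iff_not_hasGoodReductionAtPrime p).mp h hgood
  obtain ⟨ι₀⟩ := PadicAlgCl.nonempty_ringEquiv_complex p
  obtain ⟨ι', -, hι'⟩ := X11b.exists_datum_forall_mem_iff p ι₀ hK hpv
  -- frame 1: Thm. 5.7 (1) — torsion and BOTH rational halves
  obtain ⟨ΩK₁, Ωp₁, L₁, hΩK₁, hL₁, htors, hrat⟩ :=
    h57 ι' W K v vbar κ γ Dt.isNewformOf hp hord hirrK hK hHN hsplit hodd h3 hι' hvbar hne hκ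
  obtain ⟨⟨⟨k, hk⟩, ⟨k', hk'⟩⟩, -⟩ := hrat (toUnr p) (coe_toUnr p)
  -- frame 2: Prop. 4.2.2
  obtain ⟨ΩK₂, Ωp₂, L₂, hΩK₂, hL₂, hμ⟩ :=
    h422 ι' W K v κ γ Dt.isNewformOf hp2' hgood hK hHN hsplit hodd h3 hirrK hpv hι' hκ hγ
  -- frame 4: Thm. 5.1.3 at `τ_* P`
  obtain ⟨w₀⟩ := (inferInstance : Nonempty (InfinitePlace K))
  obtain ⟨τ, hP'⟩ := exists_algHom_map_map_eq hK ιC w₀ Dt H hP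
  obtain ⟨ΩK₄, Ωp₄, L₄, hΩK₄, hL₄, u, hu⟩ :=
    h513 ι' W K v κ γ Dt H w₀ ι (WeierstrassCurve.Affine.Point.map (W' := W) τ P) hp2 hpN hK hsplit
      hpv hι' hHN hodd h3 hκ hγ hP' hv
  have hΩp₁ := coe_units_ne_zero Ωp₁
  have hΩp₂ := coe_units_ne_zero Ωp₂
  have hΩp₄ := coe_units_ne_zero Ωp₄
  have h21 : Ideal.span ({L₂} : Set (UnrSeries p)) = Ideal.span {L₁} :=
    X11b.R1.span_singleton_eq_of_isBDPLFunction hp2 hK hκ hγ hΩK₁ hΩK₂ hΩp₁ hΩp₂ hL₁ hL₂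
  have h41 : PowerSeries.constantCoeff L₄ = PowerSeries.constantCoeff L₁ :=
    X11b.constantCoeff_eq_of_isBDPLFunction hp2 hK hκ hγ hΩK₁ hΩK₄ hΩp₁ hΩp₄ hL₁ hL₄
  -- generator and extended ideal
  obtain ⟨F, hF⟩ := (charIdeal_isPrincipal_holds p (Castella2018.AcSelmer.XAc (W.baseChange K) p κ vbar ∅ γ)).principal
  have hF' : Castella2018.AcSelmer.XAc.charIdeal (W.baseChange K) p κ vbar ∅ γ = Ideal.span {F} := hF
  set F' : UnrSeries p := PowerSeries.map (toUnr p) F with hF'def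
  have hI : (Castella2018.AcSelmer.XAc.charIdeal (W.baseChange K) p κ vbar ∅ γ).map (PowerSeries.map (toUnr p)) =
      Ideal.span {F'} := by
    rw [hF', Ideal.map_span, Set.image_singleton]
  have h0 : C ((p : unrIntegers p) ^ k) * L₁ ∈ Ideal.span ({F'} : Set (UnrSeries p)) := by
    rw [← hI]; exact hk
  have h1 : C ((p : unrIntegers p) ^ k') * F' ∈ Ideal.span ({L₁} : Set (UnrSeries p)) :=
    hk' F' (by rw [hI]; exact Ideal.mem_span_singleton_self F')
  obtain ⟨n, hn⟩ := exists_firstUnitCoeffAt_of_span_eq h21 hμ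
  -- the one-sided μ-comparison: `F' = C(p^m) · U · L₁`
  obtain ⟨m, U, hFU⟩ := exists_eq_C_pow_mul_unit_mul h0 h1 hn
  have hspan : Ideal.span ({F'} : Set (UnrSeries p)) =
      Ideal.span {C ((p : unrIntegers p) ^ m) * L₁} := by
    rw [hFU, show C ((p : unrIntegers p) ^ m) * (U : UnrSeries p) * L₁ =
      (U : UnrSeries p) * (C ((p : unrIntegers p) ^ m) * L₁) by ring,
      Ideal.span_singleton_mul_left_unit U.isUnit]
  -- the value at `𝟙`, moved to `P`, to `L₁`, and to `C(p^m) · L₁`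
  have hlog : padicLogOmega W p ι (WeierstrassCurve.Affine.Point.map (W' := W) τ P) ^ 2 =
      padicLogOmega W p ι P ^ 2 :=
    sq_padicLogOmega_map_eq_of_isHeegnerPoint W hK hHN ι ⟨Dt, H, ιC, hP⟩ τ
  rw [hlog] at hu
  set V : ℚ_[p] := ((Dt.c : ℚ_[p])⁻¹) ^ 2 *
      (1 - (W.frobeniusTrace p : ℚ_[p]) * (p : ℚ_[p])⁻¹ + (p : ℚ_[p])⁻¹) ^ 2 *
      padicLogOmega W p ι P ^ 2 with hVdef
  clear_value V
  have hL₁0 : ((PowerSeries.constantCoeff L₁ : unrIntegers p) : ℂ_[p]) =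
      ((u : unrIntegers p) : ℂ_[p]) * algebraMap ℚ_[p] ℂ_[p] V := by
    rw [← h41]; exact (UnrSeries.eq_constantCoeff_of_hasValueAt_zero hu).symm
  have hval : UnrSeries.HasValueAt (C ((p : unrIntegers p) ^ m) * L₁) 0
      (((u : unrIntegers p) : ℂ_[p]) * algebraMap ℚ_[p] ℂ_[p] ((p : ℚ_[p]) ^ m * V)) := by
    have h0 := UnrSeries.hasValueAt_zero (C ((p : unrIntegers p) ^ m) * L₁)
    have e1 : PowerSeries.constantCoeff (C ((p : unrIntegers p) ^ m) * L₁) =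
        (p : unrIntegers p) ^ m * PowerSeries.constantCoeff L₁ := by
      rw [map_mul, constantCoeff_C]
    have e2 : ∀ x : ℚ_[p], algebraMap ℚ_[p] ℂ_[p] ((p : ℚ_[p]) ^ m * x) =
        (p : ℂ_[p]) ^ m * algebraMap ℚ_[p] ℂ_[p] x := fun x ↦ by
      rw [map_mul, map_pow, map_natCast]
    have hcc : ((PowerSeries.constantCoeff (C ((p : unrIntegers p) ^ m) * L₁) : unrIntegers p) : ℂ_[p]) =
        ((u : unrIntegers p) : ℂ_[p]) * algebraMap ℚ_[p] ℂ_[p] ((p : ℚ_[p]) ^ m * V) := by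
      rw [e1, e2, Subring.coe_mul, hL₁0]
      push_cast
      ring
    rw [hcc] at h0
    exact h0
  obtain ⟨u', hu'⟩ := exists_unit_constantCoeff_eq hspan u hval
  refine ⟨htors, F, hF', u', m, ?_⟩
  rw [hu', hVdef]
  unfold padicLogOmega
  ring

/-- **… and therefore the BCS-sourced composite** `BurungaleCastellaSkinner2025.thm124a_prop422_thm513_generator_constantCoeff`
(p533331, binders `3 < p`, (irr_ℚ), …) is ALSO a theorem from the same four facts, through the landed
porting term `thm124a_prop422_thm513_generator_constantCoeff_of_thm57`.
[cite: YanZhu2024MainConjNonCM, Thm. 5.7 (1) (arXiv:2412.20078v4 l.1217–1223)]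
[cite: BurungaleCastellaSkinner2025, Thm. 1.2.4 (a) (p. 3) and Prop. 4.2.2 (p. 9)] -/
theorem thm124a_prop422_thm513_of_printFacts
    (h57 : thm57_isTorsion_charIdealXGr_eq_bdpLFunction)
    (h422 : BurungaleCastellaSkinner2025.prop422_exists_isBDPLFunction_mu_eq_zero)
    (h513 : thm513_exists_isBDPLFunction_valueAtOne_disc)
    (hC : ∀ (N : ℕ) [NeZero N], IsNewformOf.level_eq_conductorNorm (N := N)) :
    BurungaleCastellaSkinner2025.thm124a_prop422_thm513_generator_constantCoeff :=
  BurungaleCastellaSkinner2025.thm124a_prop422_thm513_generator_constantCoeff_of_thm57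
    (thm57_bcs422_cgls513_of_printFacts h57 h422 h513 hC)

/-- The one-sided composite and the BCS-sourced one with Carayol supplied by the parametrisation fact
(`nonempty_modularParametrizationData`). [cite: YanZhu2024MainConjNonCM, Thm. 5.7 (1)]
[cite: BurungaleCastellaSkinner2025, Thm. 1.2.4 (a) and Prop. 4.2.2] [cite: CastellaGrossiLeeSkinner2022, Thm. 5.1.3]
[cite: BCDTJAMS2001, Thm. A] [cite: Carayol1986] -/
theorem thm57_bcs422_cgls513_of_printFacts_of_modularity
    (h57 : thm57_isTorsion_charIdealXGr_eq_bdpLFunction)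
    (h422 : BurungaleCastellaSkinner2025.prop422_exists_isBDPLFunction_mu_eq_zero)
    (h513 : thm513_exists_isBDPLFunction_valueAtOne_disc)
    (hpar : nonempty_modularParametrizationData) :
    thm57_bcs422_cgls513_generator_constantCoeff ∧
      BurungaleCastellaSkinner2025.thm124a_prop422_thm513_generator_constantCoeff :=
  have hC : ∀ (N : ℕ) [NeZero N], IsNewformOf.level_eq_conductorNorm (N := N) :=
    fun _ _ ↦ IsNewformOf.level_eq_conductorNorm_of_exists_isNewformOf'
      (exists_isNewformOf_of_nonempty_modularParametrizationData hpar)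
  ⟨thm57_bcs422_cgls513_of_printFacts h57 h422 h513 hC, thm124a_prop422_thm513_of_printFacts h57 h422 h513 hC⟩

end OneSided

end Summit.BirchSwinnertonDyer.Rank1Residual.X11b.YZComposite

end
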